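import Mathlib
import HarnessLib
import Summits.HubbardSuperconductivity.HubbardSuperconductivity.Theorems.KLProgrammeKLRegimeSectorMultiplierPairWtBound
import Summits.HubbardSuperconductivity.HubbardSuperconductivity.Theorems.KLProgrammeKLRegimeEngineAnisoTorusSumWtFlow

/-!
# Route `KLProgramme` — engine support, route (L2): the neighbouring WEIGHTED thin × thin character-sum bound in the KL regime — keyed by an
# admissible frame with `C²` size `A` AND an order-three datum `A₃·Λ_m² ≤ a₃`, one constant per `a₃`

Cell `gate-hubbard-kl`, seat p3 (g10); program «W2 = weighted overlap rows», file W2f (part 1): the weighted twin of k3c2-p3's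
`charSum_klAnisoPair_nb_le_frameKeyed` / `charSum_klAnisoPair_nb_of_thresholds` (`…SectorMultiplierJumpRegime` §1–§2).  The weight is the
MOMENT weight at scale `m` of the finer factor, `w_m(z) = 1 + (Λ_mβ/(2M))|z̃₁| + Λ_m|z̃₂⁰| + Λ_m|z̃₂¹|`, reached from the rate weight of
`charSumWt_klAnisoPair_le_uniform` by `one_add_scaleWeight_le` (factor `(π/2)·max κ_t κ_c`).

* **`charSumWt_klAnisoPair_nb_le_frameKeyed`** — for `1 ≤ m` and the three-step scale thresholds: `Σ_z w_m(z)‖S_{F_{m,ω}F_{m−1,a′}}(z)‖ ≤ C_T·M·L²`;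
* **`charSumWt_klAnisoPair_nb_of_thresholds (a₃)`** — `∃ C_T > 0`: for every `R` (`Gfr ≥ 0`), `0 < c ≤ κ₀/(12(Gfr₂+1))`,
  `0 < U ≤ min 1 (κ₀/(24(Gfr₀+Gfr₁+1)))`, `klBetaMin ≤ β ≤ e^{c/U²}`, `μ ∈ klWindowC`, `FrameOK R U n_β μ K`, ORDER-THREE DATUM
  `‖D³(frameShift K)‖ ≤ A₃`, `β² ≤ L`, `β ≤ M`, every `1 ≤ m ≤ n_β+1` WITH `A₃Λ_m² ≤ a₃`, all sectors: the bound `≤ C_T·M·L²`.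

Everything is proved; no definitions, no named facts. [cite: BenfattoGiulianiMastropietro2006, §2.7 (2.71a), §2.8 (2.77)]
-/

noncomputable section

namespace Summit.HubbardSuperconductivity.HubbardSuperconductivity.Theorems.TorusFourierL2

set_option linter.dupNamespace false -- summit = problem name (single-conjunct summit), D-0017

open Set Finset Literature.MathematicalPhysics.QuantumLattice Literature.MathematicalPhysics.QuantumLattice.BandSectorCounting
open Literature.MathematicalPhysics.QuantumLattice.FermiRG Literature.Probability.LatticeModels Literature.Analysis.SpecialFunctions
open Summit.HubbardSuperconductivity.HubbardSuperconductivity.Theorems.DispersionFlow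
open Summit.HubbardSuperconductivity.HubbardSuperconductivity.Theorems.KLRegimeSplit
open Summit.HubbardSuperconductivity.HubbardSuperconductivity.Theorems.KLProgrammeLegKernels
open Summit.HubbardSuperconductivity.HubbardSuperconductivity.Theorems.PerturbedFermiCurve
open scoped Real

section FrameKeyed

variable {L M : ℕ} [NeZero L] [NeZero M] {a b : ℝ} (B : BandBounds a b) {K : TrigPolyC4v} {A : ℝ}
  (hA : ∀ p : Momentum, ∀ j ≤ 2, ‖iteratedFDeriv ℝ j (frameShift K) p‖ ≤ A) (hADt : 2 * A < B.Dtmin)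
  {μ e₀ z β : ℝ} (he : 0 < e₀) (hz : 0 < z) (hz1 : z ≤ 1) (hgap : e₀ + A + z ^ 2 < -μ) (h3 : e₀ + A - μ ≤ 3)
  (hlo : a ≤ μ - A - e₀) (hhi : μ + A + e₀ ≤ b) (hβ : 0 < β) (hρA : 4 * A < 2 * B.rhomin)
  {d : ℝ} (hd : 0 < d) (hd1 : ∀ u, |deriv (bgmCutoffSq e₀) u| ≤ d) (hd2 : ∀ u, |iteratedDeriv 2 (bgmCutoffSq e₀) u| ≤ d)
  (hd3 : ∀ u, |iteratedDeriv 3 (bgmCutoffSq e₀) u| ≤ d)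
  {A₃ a₃ : ℝ} (hA3 : ∀ p : Momentum, ‖iteratedFDeriv ℝ 3 (frameShift K) p‖ ≤ A₃)
  {Ba : ℝ} (hB0 : 0 < Ba)
  (hB : ∀ (i : ℕ), i ≤ 2 → ∀ (n : ℕ) (ω : ℤ) (θ₀ : ℝ) (q w : Fin 2 → ℝ) (t : ℝ) {r₀ : ℝ}, 0 < r₀ →
    r₀ ≤ ‖momToComplex (q + t • w)‖ → |sectorRelAngle θ₀ (q + t • w)| < π →
    ‖iteratedDeriv i (fun t : ℝ => sectorWeightCirc n ω (polarAngle (q + t • w))) t‖ ≤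
      (2 : ℕ).factorial * Ba * ((1 + (sectorWidth n)⁻¹ * (2 : ℕ).factorial) * ‖momToComplex w‖ / r₀) ^ i)
  {Ba3 : ℝ} (hB30 : 0 < Ba3)
  (hB3 : ∀ (i : ℕ), i ≤ 3 → ∀ (n : ℕ) (ω : ℤ) (θ₀ : ℝ) (q w : Fin 2 → ℝ) (t : ℝ) {r₀ : ℝ}, 0 < r₀ →
    r₀ ≤ ‖momToComplex (q + t • w)‖ → |sectorRelAngle θ₀ (q + t • w)| < π →
    ‖iteratedDeriv i (fun t : ℝ => sectorWeightCirc n ω (polarAngle (q + t • w))) t‖ ≤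
      (3 : ℕ).factorial * Ba3 * ((1 + (sectorWidth n)⁻¹ * (3 : ℕ).factorial) * ‖momToComplex w‖ / r₀) ^ i)
  {cG c1 ρb Y κ cT κt κ₃P κc Kc κX cN1 cN2 : ℝ}
  (hcG : cG = 4 * (d * e₀ ^ 4 * 1 + 2 * (d * e₀ ^ 2) * (d * e₀ ^ 2) + 1 * (d * e₀ ^ 4)) + 2 * (d * e₀ ^ 2 * 1 + 1 * (d * e₀ ^ 2)))
  (hc1 : c1 = d * e₀ ^ 2 * 1 + 1 * (d * e₀ ^ 2))
  (hρb : ρb = (e₀ + 3 * π / 2 * B.smax * B.Dtmin) / (B.Dtmin - 2 * A))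
  (hY : Y = (4 + 2 * A) + (4 + 4 * A) * (2 * ρb + 5))
  (hκ : κ = cG * Y ^ 2 + 2 * c1 * (4 + 4 * A) * (9 / 4) * e₀ + 8 * c1 * Ba * Y * 12 * e₀ + 2 * Ba * 72 * e₀ ^ 2 +
    8 * Ba ^ 2 * 36 * e₀ ^ 2)
  (hcT : cT = 8 * (d * e₀ ^ 6 * 1 + 3 * (d * e₀ ^ 4) * (d * e₀ ^ 2) + 3 * (d * e₀ ^ 2) * (d * e₀ ^ 4) + 1 * (d * e₀ ^ 6)) +
    12 * (d * e₀ ^ 4 * 1 + 2 * (d * e₀ ^ 2) * (d * e₀ ^ 2) + 1 * (d * e₀ ^ 4)))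
  (hκt : κt = max 1 cT)
  (hκ₃P : κ₃P = (8 * (d * e₀ ^ 6 * 1 + 3 * (d * e₀ ^ 4) * (d * e₀ ^ 2) + 3 * (d * e₀ ^ 2) * (d * e₀ ^ 4) + 1 * (d * e₀ ^ 6)) +
        12 * (d * e₀ ^ 4 * 1 + 2 * (d * e₀ ^ 2) * (d * e₀ ^ 2) + 1 * (d * e₀ ^ 4))) * (4 + 2 * A) ^ 3 +
      (12 * (d * e₀ ^ 4 * 1 + 2 * (d * e₀ ^ 2) * (d * e₀ ^ 2) + 1 * (d * e₀ ^ 4)) + 6 * (d * e₀ ^ 2 * 1 + 1 * (d * e₀ ^ 2))) *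
        (4 + 2 * A) * (4 + 4 * A) * e₀ + 2 * (d * e₀ ^ 2 * 1 + 1 * (d * e₀ ^ 2)) * (4 * e₀ ^ 2 + 8 * a₃) +
      216 * Ba3 * ((4 * (d * e₀ ^ 4 * 1 + 2 * (d * e₀ ^ 2) * (d * e₀ ^ 2) + 1 * (d * e₀ ^ 4)) + 2 * (d * e₀ ^ 2 * 1 + 1 * (d * e₀ ^ 2))) *
        (4 + 2 * A) ^ 2 * e₀ + 2 * (d * e₀ ^ 2 * 1 + 1 * (d * e₀ ^ 2)) * (4 + 4 * A) * e₀ ^ 2) +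
      (2592 * Ba3 + 15552 * Ba3 ^ 2) * (d * e₀ ^ 2 * 1 + 1 * (d * e₀ ^ 2)) * (4 + 2 * A) * e₀ ^ 2 + (2592 * Ba3 + 46656 * Ba3 ^ 2) * e₀ ^ 3)
  (hκc : κc = max 1 (max κ₃P κ)) (hKc : Kc = κc ^ 2)
  (hκX : κX = 4 * (3 * Real.sqrt 2 * π * Real.sqrt Kc + 2 * e₀) ^ 2 / e₀ +
    96 / (π * e₀ ^ 2) * ((π * Real.sqrt Kc / 2) * (π * Real.sqrt Kc / 2 + e₀) ^ 2))
  (hcN1 : cN1 = Real.sqrt 2 * (e₀ + (4 + 4 * A) * ρb ^ 2) / ((2 * B.rhomin - 4 * A) * π) + 2)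
  (hcN2 : cN2 = 2 * Real.sqrt 2 * ρb / π + 2)

set_option maxHeartbeats 1600000 in
include B hA hADt he hz hz1 hgap h3 hlo hhi hβ hρA hd hd1 hd2 hd3 hA3 hB0 hB hB30 hB3 hcG hc1 hρb hY hκ hcT hκt hκ₃P hκc hKc hκX hcN1 hcN2 in
/-- **The neighbouring WEIGHTED thin × thin bound on an admissible frame, moment weight at the finer scale `m`**: for `1 ≤ m`, the three-step
thresholds and the datum `A₃Λ_m² ≤ a₃`,
`Σ_z (1 + (Λ_mβ/(2M))|z̃₁| + Λ_m|z̃₂⁰| + Λ_m|z̃₂¹|)·‖S_{F_{m,ω₁}F_{m−1,a′}}(z)‖ ≤ (π/2)·max κ_t κ_c · √(a·b/e₀)·M·L²`.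
[cite: BenfattoGiulianiMastropietro2006, §2.7 (2.71a), §2.8 (2.77)] -/
theorem charSumWt_klAnisoPair_nb_le_frameKeyed {m : ℕ} (hm : 1 ≤ m) (ha3 : A₃ * klScale e₀ m ^ 2 ≤ a₃)
    (hM : klScale e₀ m * β < π * (2 * M - 5)) (hMβ : β * e₀ ≤ M)
    (hLz : 3 * |2 * π / (L : ℝ)| * ((2 : ℝ) ^ m + 1 / 2) ≤ z) (hL16 : 2 * π * (16 : ℝ) ^ m ≤ L) (hΛβ : π / (4 * β) ≤ klScale e₀ m)
    (ω₁ : Fin (sectorCount m)) (a' : Fin (sectorCount (m - 1))) :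
    ∑ zz : TorusSite 1 (2 * M) × TorusSite 2 L,
      (1 + klScale e₀ m * β / (2 * M) * |(((zz.1 0).valMinAbs : ℤ) : ℝ)| + klScale e₀ m * |(((zz.2 0).valMinAbs : ℤ) : ℝ)| +
          klScale e₀ m * |(((zz.2 1).valMinAbs : ℤ) : ℝ)|) *
      ‖∑ q : TorusSite 1 (2 * M) × TorusSite 2 L, (torusChar q.1 zz.1 * torusChar q.2 zz.2) •
        (klAnisoFamily L M β μ K e₀ m ω₁ (⟨(q.1 0).val, ZMod.val_lt (q.1 0)⟩, q.2) *
          klAnisoFamily L M β μ K e₀ (m - 1) a' (⟨(q.1 0).val, ZMod.val_lt (q.1 0)⟩, q.2))‖ ≤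
      π / 2 * max κt κc *
        (Real.sqrt (524288 * (π * Real.sqrt (κt ^ 2) + 1) * ((1 + 12 * Real.sqrt 2) ^ 2 / 4 + 1 / 16) * κX * (240 / π * (cN1 * cN2)) / e₀) *
          M * (L : ℝ) ^ 2) := by
  have hmain := charSumWt_klAnisoPair_le_uniform B hA hADt he hz hz1 hgap h3 hlo hhi hβ hρA (Nat.sub_le m 1) ω₁ a' hd hd1 hd2 hd3 hA3
    (Z := fun p : Fin 2 → ℝ => gnCutoff ((π + z) ^ 2 / π ^ 2) ((π + z) ^ 2) (p 0 ^ 2) *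
      gnCutoff ((π + z) ^ 2 / π ^ 2) ((π + z) ^ 2) (p 1 ^ 2) *
      ((radialCutoffC (1 / 2) (momToComplex p) * sectorWeightCirc m ((ω₁ : ℕ) : ℤ) (polarAngle p)) *
        (radialCutoffC (1 / 2) (momToComplex p) * sectorWeightCirc (m - 1) ((a' : ℕ) : ℤ) (polarAngle p))))
    (fun _ => rfl)
    (Φ := fun kp : ℝ × (Fin 2 → ℝ) => ((bgmCutoffSq e₀ ((16 : ℝ) ^ m * (kp.1 ^ 2 + frameLevel μ K (WithLp.toLp 2 kp.2) ^ 2)) *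
      bgmCutoffSq e₀ ((16 : ℝ) ^ (m - 1) * (kp.1 ^ 2 + frameLevel μ K (WithLp.toLp 2 kp.2) ^ 2)) *
      (gnCutoff ((π + z) ^ 2 / π ^ 2) ((π + z) ^ 2) (kp.2 0 ^ 2) * gnCutoff ((π + z) ^ 2 / π ^ 2) ((π + z) ^ 2) (kp.2 1 ^ 2) *
        ((radialCutoffC (1 / 2) (momToComplex kp.2) * sectorWeightCirc m ((ω₁ : ℕ) : ℤ) (polarAngle kp.2)) *
          (radialCutoffC (1 / 2) (momToComplex kp.2) * sectorWeightCirc (m - 1) ((a' : ℕ) : ℤ) (polarAngle kp.2)))) : ℝ) : ℂ))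
    (fun _ _ => rfl)
    (Gs := fun q : TorusSite 1 (2 * M) × TorusSite 2 L =>
      klAnisoFamily L M β μ K e₀ m ω₁ (⟨(q.1 0).val, ZMod.val_lt (q.1 0)⟩, q.2) *
        klAnisoFamily L M β μ K e₀ (m - 1) a' (⟨(q.1 0).val, ZMod.val_lt (q.1 0)⟩, q.2))
    (fun _ => rfl) hB0 hB hB30 hB3 hcG hc1 hρb hY hκ hcT hκt hκ₃P hκc hKc hκX hcN1 hcN2 (by omega) ha3 hM hMβ hLz hL16 hΛβ
  -- the constants
  have hκt1 : 1 ≤ κt := by rw [hκt]; exact le_max_left _ _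
  have hκt0 : 0 < κt := lt_of_lt_of_le one_pos hκt1
  have hsqt : Real.sqrt (κt ^ 2) = κt := Real.sqrt_sq hκt0.le
  have hκc1 : 1 ≤ κc := by rw [hκc]; exact le_max_left _ _
  have hκc0 : 0 < κc := lt_of_lt_of_le one_pos hκc1
  have hsqK : Real.sqrt Kc = κc := by rw [hKc]; exact Real.sqrt_sq hκc0.le
  have hΛ : 0 ≤ klScale e₀ m := by rw [klScale]; positivity
  have hP0 : (0 : ℝ) < ((2 * M : ℕ) : ℝ) := Nat.cast_pos.2 (Nat.pos_of_ne_zero (mul_ne_zero two_ne_zero (NeZero.ne M)))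
  have hP : ((2 * M : ℕ) : ℝ) = 2 * (M : ℝ) := by push_cast; ring
  have hfac : 0 ≤ π / 2 * max κt κc := by have := le_max_left κt κc; have := Real.pi_pos; positivity
  -- termwise weight domination
  have hdom : ∀ zz : TorusSite 1 (2 * M) × TorusSite 2 L,
      (1 + klScale e₀ m * β / (2 * M) * |(((zz.1 0).valMinAbs : ℤ) : ℝ)| + klScale e₀ m * |(((zz.2 0).valMinAbs : ℤ) : ℝ)| +
          klScale e₀ m * |(((zz.2 1).valMinAbs : ℤ) : ℝ)|) ≤
        π / 2 * max κt κc *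
          (1 + 2 * klScale e₀ m * β / (((2 * M : ℕ) : ℝ) * π * Real.sqrt (κt ^ 2)) * |(((zz.1 0).valMinAbs : ℤ) : ℝ)| +
            2 * klScale e₀ m / (π * Real.sqrt Kc) * |(((zz.2 0).valMinAbs : ℤ) : ℝ)| +
            2 * klScale e₀ m / (π * Real.sqrt Kc) * |(((zz.2 1).valMinAbs : ℤ) : ℝ)|) := by
    intro zz
    rw [hsqt, hsqK]
    have h := one_add_scaleWeight_le (Λ := klScale e₀ m) (β := β) (Ng := ((2 * M : ℕ) : ℝ)) (κt := κt) (κ := κc)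
      (c := |(((zz.1 0).valMinAbs : ℤ) : ℝ)|) (t := |(((zz.2 0).valMinAbs : ℤ) : ℝ)| + |(((zz.2 1).valMinAbs : ℤ) : ℝ)|)
      (a := |(((zz.2 0).valMinAbs : ℤ) : ℝ)|) (b := |(((zz.2 1).valMinAbs : ℤ) : ℝ)|)
      hΛ hβ.le hP0 hκt1 hκc1 (abs_nonneg _) (abs_nonneg _) (abs_nonneg _) le_rfl
    rw [hP] at h ⊢
    calc _ = 1 + klScale e₀ m * (β / (2 * (M : ℝ)) * |(((zz.1 0).valMinAbs : ℤ) : ℝ)| +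
          (|(((zz.2 0).valMinAbs : ℤ) : ℝ)| + |(((zz.2 1).valMinAbs : ℤ) : ℝ)|)) := by ring
      _ ≤ _ := h
  calc _ ≤ ∑ zz : TorusSite 1 (2 * M) × TorusSite 2 L, (π / 2 * max κt κc *
          (1 + 2 * klScale e₀ m * β / (((2 * M : ℕ) : ℝ) * π * Real.sqrt (κt ^ 2)) * |(((zz.1 0).valMinAbs : ℤ) : ℝ)| +
            2 * klScale e₀ m / (π * Real.sqrt Kc) * |(((zz.2 0).valMinAbs : ℤ) : ℝ)| +
            2 * klScale e₀ m / (π * Real.sqrt Kc) * |(((zz.2 1).valMinAbs : ℤ) : ℝ)|)) *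
        ‖∑ q : TorusSite 1 (2 * M) × TorusSite 2 L, (torusChar q.1 zz.1 * torusChar q.2 zz.2) •
          (klAnisoFamily L M β μ K e₀ m ω₁ (⟨(q.1 0).val, ZMod.val_lt (q.1 0)⟩, q.2) *
            klAnisoFamily L M β μ K e₀ (m - 1) a' (⟨(q.1 0).val, ZMod.val_lt (q.1 0)⟩, q.2))‖ :=
        sum_le_sum fun zz _ => mul_le_mul_of_nonneg_right (hdom zz) (norm_nonneg _)
    _ = π / 2 * max κt κc * ∑ zz : TorusSite 1 (2 * M) × TorusSite 2 L,
          (1 + 2 * klScale e₀ m * β / (((2 * M : ℕ) : ℝ) * π * Real.sqrt (κt ^ 2)) * |(((zz.1 0).valMinAbs : ℤ) : ℝ)| +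
            2 * klScale e₀ m / (π * Real.sqrt Kc) * |(((zz.2 0).valMinAbs : ℤ) : ℝ)| +
            2 * klScale e₀ m / (π * Real.sqrt Kc) * |(((zz.2 1).valMinAbs : ℤ) : ℝ)|) *
        ‖∑ q : TorusSite 1 (2 * M) × TorusSite 2 L, (torusChar q.1 zz.1 * torusChar q.2 zz.2) •
          (klAnisoFamily L M β μ K e₀ m ω₁ (⟨(q.1 0).val, ZMod.val_lt (q.1 0)⟩, q.2) *
            klAnisoFamily L M β μ K e₀ (m - 1) a' (⟨(q.1 0).val, ZMod.val_lt (q.1 0)⟩, q.2))‖ := by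
        rw [mul_sum]; exact sum_congr rfl fun zz _ => by ring
    _ ≤ _ := mul_le_mul_of_nonneg_left hmain hfac

end FrameKeyed

/-! ### §2 The KL regime: the weighted neighbouring bound with ONE constant per order-three allowance `a₃` -/

set_option maxHeartbeats 1600000 in
/-- **The weighted neighbouring thin × thin bound in the KL regime** (absolute thresholds exposed, `B = bandBounds (−6/5) (−1/10)`,
`κ₀ = min (min (Dt_min/4) (ρ_min/4)) (1/40)`, order-three allowance `a₃`, any real): `∃ C_T > 0` such that for every `R` (`Gfr ≥ 0`),
`0 < c ≤ κ₀/(12(Gfr₂+1))`, `0 < U ≤ min 1 (κ₀/(24(Gfr₀+Gfr₁+1)))`, `klBetaMin ≤ β ≤ e^{c/U²}`, `μ ∈ klWindowC`, `FrameOK R U (nScales β) μ K`, any `A₃`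
with `‖D³(frameShift K)‖ ≤ A₃`, `β² ≤ L`, `β ≤ M`, every scale `1 ≤ m ≤ nScales β + 1` with `A₃·Λ_m² ≤ a₃`, and all sectors: the moment-weighted
(scale `m`) `ℓ¹` character sum of `F_{m,ω}·F_{m−1,a}` (`e₀ = klE0`) is `≤ C_T·M·L²`. [cite: BenfattoGiulianiMastropietro2006, §2.7 (2.71a), §2.8 (2.77)] -/
theorem charSumWt_klAnisoPair_nb_of_thresholds (ha : (-4 : ℝ) < -(6 / 5)) (hab : (-(6 / 5) : ℝ) ≤ -(1 / 10))
    (hb : (-(1 / 10) : ℝ) < 0) (a₃ : ℝ) :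
    ∃ CT : ℝ, 0 < CT ∧ ∀ (R : RenConsts), (∀ j, 0 ≤ R.Gfr j) →
      ∀ (c U : ℝ), 0 < c →
      c ≤ min (min ((bandBounds ha hab hb).Dtmin / 4) ((bandBounds ha hab hb).rhomin / 4)) (1 / 40) / (12 * (R.Gfr 2 + 1)) → 0 < U →
      U ≤ min 1 (min (min ((bandBounds ha hab hb).Dtmin / 4) ((bandBounds ha hab hb).rhomin / 4)) (1 / 40) / (24 * (R.Gfr 0 + R.Gfr 1 + 1))) →
      ∀ β : ℝ, klBetaMin ≤ β → β ≤ Real.exp (c / U ^ 2) → ∀ μ ∈ klWindowC, ∀ K : TrigPolyC4v, FrameOK R U (nScales β) μ K →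
      ∀ A₃ : ℝ, (∀ p : Momentum, ‖iteratedFDeriv ℝ 3 (frameShift K) p‖ ≤ A₃) →
      ∀ (L M : ℕ) [NeZero L] [NeZero M], β ^ 2 ≤ (L : ℝ) → β ≤ (M : ℝ) → ∀ m : ℕ, 1 ≤ m → m ≤ nScales β + 1 →
        A₃ * klScale klE0 m ^ 2 ≤ a₃ →
        ∀ (ω : Fin (sectorCount m)) (a' : Fin (sectorCount (m - 1))),
          ∑ zz : TorusSite 1 (2 * M) × TorusSite 2 L,
            (1 + klScale klE0 m * β / (2 * M) * |(((zz.1 0).valMinAbs : ℤ) : ℝ)| + klScale klE0 m * |(((zz.2 0).valMinAbs : ℤ) : ℝ)| +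
                klScale klE0 m * |(((zz.2 1).valMinAbs : ℤ) : ℝ)|) *
            ‖∑ q : TorusSite 1 (2 * M) × TorusSite 2 L, (torusChar q.1 zz.1 * torusChar q.2 zz.2) •
              (klAnisoFamily L M β μ K klE0 m ω (⟨(q.1 0).val, ZMod.val_lt (q.1 0)⟩, q.2) *
                klAnisoFamily L M β μ K klE0 (m - 1) a' (⟨(q.1 0).val, ZMod.val_lt (q.1 0)⟩, q.2))‖ ≤ CT * M * (L : ℝ) ^ 2 := by
  -- the window band bounds and the absolute frame-size threshold
  set B : BandBounds (-(6 / 5)) (-(1 / 10)) := bandBounds ha hab hb with hBdef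
  set κ₀ : ℝ := min (min (B.Dtmin / 4) (B.rhomin / 4)) (1 / 40) with hκ₀
  have hDt := B.Dtmin_pos
  have hrh := B.rhomin_pos
  have hκ₀pos : 0 < κ₀ := by rw [hκ₀]; exact lt_min (lt_min (by positivity) (by positivity)) (by norm_num)
  have hκ₀Dt : κ₀ ≤ B.Dtmin / 4 := (min_le_left _ _).trans (min_le_left _ _)
  have hκ₀rh : κ₀ ≤ B.rhomin / 4 := (min_le_left _ _).trans (min_le_right _ _)
  have hκ₀40 : κ₀ ≤ 1 / 40 := min_le_right _ _
  -- the cutoff constants (orders ≤ 3) and the angular constants at orders 2 and 3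
  have he : (0 : ℝ) < klE0 := by norm_num [klE0]
  obtain ⟨d₀, hd₀, hd₀1, hd₀2, hd₀3⟩ := exists_abs_derivs3_bgmCutoffSq_le he
  obtain ⟨B₀, hB₀0, hB₀⟩ := exists_norm_iteratedDeriv_sectorWeightCirc_polarAngle_line_le 2
  obtain ⟨B₁, hB₁0, hB₁⟩ := exists_norm_iteratedDeriv_sectorWeightCirc_polarAngle_line_le 3
  have hd : (0 : ℝ) < d₀ + 1 := by linarith
  have hd1 : ∀ u, |deriv (bgmCutoffSq klE0) u| ≤ d₀ + 1 := fun u => (hd₀1 u).trans (by linarith)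
  have hd2 : ∀ u, |iteratedDeriv 2 (bgmCutoffSq klE0) u| ≤ d₀ + 1 := fun u => (hd₀2 u).trans (by linarith)
  have hd3 : ∀ u, |iteratedDeriv 3 (bgmCutoffSq klE0) u| ≤ d₀ + 1 := fun u => (hd₀3 u).trans (by linarith)
  have hBa : (0 : ℝ) < B₀ + 1 := by linarith
  have hB : ∀ (i : ℕ), i ≤ 2 → ∀ (n : ℕ) (ω : ℤ) (θ₀ : ℝ) (q w : Fin 2 → ℝ) (t : ℝ) {r₀ : ℝ}, 0 < r₀ →
      r₀ ≤ ‖momToComplex (q + t • w)‖ → |sectorRelAngle θ₀ (q + t • w)| < π →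
      ‖iteratedDeriv i (fun t : ℝ => sectorWeightCirc n ω (polarAngle (q + t • w))) t‖ ≤
        (2 : ℕ).factorial * (B₀ + 1) * ((1 + (sectorWidth n)⁻¹ * (2 : ℕ).factorial) * ‖momToComplex w‖ / r₀) ^ i := by
    intro i hi n ω θ₀ q w t r₀ hr₀ hr hθ
    refine (hB₀ i hi n ω θ₀ q w t hr₀ hr hθ).trans ?_
    have hX : 0 ≤ ((1 + (sectorWidth n)⁻¹ * (2 : ℕ).factorial) * ‖momToComplex w‖ / r₀) ^ i := by
      have := sectorWidth_pos n; positivity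
    have h2 : (0 : ℝ) ≤ (2 : ℕ).factorial := Nat.cast_nonneg _
    nlinarith [mul_nonneg h2 hX]
  have hBa3 : (0 : ℝ) < B₁ + 1 := by linarith
  have hB3 : ∀ (i : ℕ), i ≤ 3 → ∀ (n : ℕ) (ω : ℤ) (θ₀ : ℝ) (q w : Fin 2 → ℝ) (t : ℝ) {r₀ : ℝ}, 0 < r₀ →
      r₀ ≤ ‖momToComplex (q + t • w)‖ → |sectorRelAngle θ₀ (q + t • w)| < π →
      ‖iteratedDeriv i (fun t : ℝ => sectorWeightCirc n ω (polarAngle (q + t • w))) t‖ ≤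
        (3 : ℕ).factorial * (B₁ + 1) * ((1 + (sectorWidth n)⁻¹ * (3 : ℕ).factorial) * ‖momToComplex w‖ / r₀) ^ i := by
    intro i hi n ω θ₀ q w t r₀ hr₀ hr hθ
    refine (hB₁ i hi n ω θ₀ q w t hr₀ hr hθ).trans ?_
    have hX : 0 ≤ ((1 + (sectorWidth n)⁻¹ * (3 : ℕ).factorial) * ‖momToComplex w‖ / r₀) ^ i := by
      have := sectorWidth_pos n; positivity
    have h2 : (0 : ℝ) ≤ (3 : ℕ).factorial := Nat.cast_nonneg _
    nlinarith [mul_nonneg h2 hX]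
  -- the absolute constants
  set A : ℝ := κ₀ / 4 with hAdef
  have hA0 : 0 < A := by rw [hAdef]; positivity
  have hDtA : 0 < B.Dtmin - 2 * A := by rw [hAdef]; linarith
  have hrhA : 0 < 2 * B.rhomin - 4 * A := by rw [hAdef]; linarith
  have hsm := B.smax_pos
  have hπ := Real.pi_pos
  obtain ⟨ρb, hρb⟩ : ∃ ρb : ℝ, ρb = (klE0 + 3 * π / 2 * B.smax * B.Dtmin) / (B.Dtmin - 2 * A) := ⟨_, rfl⟩
  obtain ⟨cG, hcG⟩ : ∃ cG : ℝ, cG = 4 * ((d₀ + 1) * klE0 ^ 4 * 1 + 2 * ((d₀ + 1) * klE0 ^ 2) * ((d₀ + 1) * klE0 ^ 2) +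
      1 * ((d₀ + 1) * klE0 ^ 4)) + 2 * ((d₀ + 1) * klE0 ^ 2 * 1 + 1 * ((d₀ + 1) * klE0 ^ 2)) := ⟨_, rfl⟩
  obtain ⟨c1, hc1⟩ : ∃ c1 : ℝ, c1 = (d₀ + 1) * klE0 ^ 2 * 1 + 1 * ((d₀ + 1) * klE0 ^ 2) := ⟨_, rfl⟩
  obtain ⟨Y, hY⟩ : ∃ Y : ℝ, Y = (4 + 2 * A) + (4 + 4 * A) * (2 * ρb + 5) := ⟨_, rfl⟩
  obtain ⟨κ, hκ⟩ : ∃ κ : ℝ, κ = cG * Y ^ 2 + 2 * c1 * (4 + 4 * A) * (9 / 4) * klE0 + 8 * c1 * (B₀ + 1) * Y * 12 * klE0 +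
      2 * (B₀ + 1) * 72 * klE0 ^ 2 + 8 * (B₀ + 1) ^ 2 * 36 * klE0 ^ 2 := ⟨_, rfl⟩
  obtain ⟨cT, hcT⟩ : ∃ cT : ℝ, cT = 8 * ((d₀ + 1) * klE0 ^ 6 * 1 + 3 * ((d₀ + 1) * klE0 ^ 4) * ((d₀ + 1) * klE0 ^ 2) +
      3 * ((d₀ + 1) * klE0 ^ 2) * ((d₀ + 1) * klE0 ^ 4) + 1 * ((d₀ + 1) * klE0 ^ 6)) +
      12 * ((d₀ + 1) * klE0 ^ 4 * 1 + 2 * ((d₀ + 1) * klE0 ^ 2) * ((d₀ + 1) * klE0 ^ 2) + 1 * ((d₀ + 1) * klE0 ^ 4)) := ⟨_, rfl⟩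
  obtain ⟨κt, hκt⟩ : ∃ κt : ℝ, κt = max 1 cT := ⟨_, rfl⟩
  obtain ⟨κ₃P, hκ₃P⟩ : ∃ κ₃P : ℝ, κ₃P = (8 * ((d₀ + 1) * klE0 ^ 6 * 1 + 3 * ((d₀ + 1) * klE0 ^ 4) * ((d₀ + 1) * klE0 ^ 2) +
        3 * ((d₀ + 1) * klE0 ^ 2) * ((d₀ + 1) * klE0 ^ 4) + 1 * ((d₀ + 1) * klE0 ^ 6)) +
        12 * ((d₀ + 1) * klE0 ^ 4 * 1 + 2 * ((d₀ + 1) * klE0 ^ 2) * ((d₀ + 1) * klE0 ^ 2) + 1 * ((d₀ + 1) * klE0 ^ 4))) *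
          (4 + 2 * A) ^ 3 +
      (12 * ((d₀ + 1) * klE0 ^ 4 * 1 + 2 * ((d₀ + 1) * klE0 ^ 2) * ((d₀ + 1) * klE0 ^ 2) + 1 * ((d₀ + 1) * klE0 ^ 4)) +
          6 * ((d₀ + 1) * klE0 ^ 2 * 1 + 1 * ((d₀ + 1) * klE0 ^ 2))) * (4 + 2 * A) * (4 + 4 * A) * klE0 +
        2 * ((d₀ + 1) * klE0 ^ 2 * 1 + 1 * ((d₀ + 1) * klE0 ^ 2)) * (4 * klE0 ^ 2 + 8 * a₃) +
      216 * (B₁ + 1) * ((4 * ((d₀ + 1) * klE0 ^ 4 * 1 + 2 * ((d₀ + 1) * klE0 ^ 2) * ((d₀ + 1) * klE0 ^ 2) + 1 * ((d₀ + 1) * klE0 ^ 4)) +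
          2 * ((d₀ + 1) * klE0 ^ 2 * 1 + 1 * ((d₀ + 1) * klE0 ^ 2))) * (4 + 2 * A) ^ 2 * klE0 +
        2 * ((d₀ + 1) * klE0 ^ 2 * 1 + 1 * ((d₀ + 1) * klE0 ^ 2)) * (4 + 4 * A) * klE0 ^ 2) +
      (2592 * (B₁ + 1) + 15552 * (B₁ + 1) ^ 2) * ((d₀ + 1) * klE0 ^ 2 * 1 + 1 * ((d₀ + 1) * klE0 ^ 2)) * (4 + 2 * A) * klE0 ^ 2 +
      (2592 * (B₁ + 1) + 46656 * (B₁ + 1) ^ 2) * klE0 ^ 3 := ⟨_, rfl⟩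
  obtain ⟨κc, hκc⟩ : ∃ κc : ℝ, κc = max 1 (max κ₃P κ) := ⟨_, rfl⟩
  obtain ⟨Kc, hKc⟩ : ∃ Kc : ℝ, Kc = κc ^ 2 := ⟨_, rfl⟩
  obtain ⟨κX, hκX⟩ : ∃ κX : ℝ, κX = 4 * (3 * Real.sqrt 2 * π * Real.sqrt Kc + 2 * klE0) ^ 2 / klE0 +
      96 / (π * klE0 ^ 2) * ((π * Real.sqrt Kc / 2) * (π * Real.sqrt Kc / 2 + klE0) ^ 2) := ⟨_, rfl⟩
  obtain ⟨cN1, hcN1⟩ : ∃ cN1 : ℝ, cN1 = Real.sqrt 2 * (klE0 + (4 + 4 * A) * ρb ^ 2) / ((2 * B.rhomin - 4 * A) * π) + 2 := ⟨_, rfl⟩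
  obtain ⟨cN2, hcN2⟩ : ∃ cN2 : ℝ, cN2 = 2 * Real.sqrt 2 * ρb / π + 2 := ⟨_, rfl⟩
  have hρb0 : 0 ≤ ρb := by rw [hρb]; positivity
  have hκt1 : 1 ≤ κt := by rw [hκt]; exact le_max_left _ _
  have hκt0 : 0 < κt := lt_of_lt_of_le one_pos hκt1
  have hκc1 : 1 ≤ κc := by rw [hκc]; exact le_max_left _ _
  have hκX0 : 0 < κX := by rw [hκX]; positivity
  have hcN10 : 0 < cN1 := by rw [hcN1]; positivity
  have hcN20 : 0 < cN2 := by rw [hcN2]; positivity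
  have hsqt : Real.sqrt (κt ^ 2) = κt := Real.sqrt_sq hκt0.le
  have hfac : 0 < π / 2 * max κt κc := by have := le_max_left κt κc; positivity
  have hS0 : 0 < Real.sqrt (524288 * (π * Real.sqrt (κt ^ 2) + 1) * ((1 + 12 * Real.sqrt 2) ^ 2 / 4 + 1 / 16) * κX *
      (240 / π * (cN1 * cN2)) / klE0) := Real.sqrt_pos.2 (by rw [hsqt]; positivity)
  refine ⟨π / 2 * max κt κc * Real.sqrt (524288 * (π * Real.sqrt (κt ^ 2) + 1) * ((1 + 12 * Real.sqrt 2) ^ 2 / 4 + 1 / 16) * κX *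
      (240 / π * (cN1 * cN2)) / klE0), by positivity, ?_⟩
  intro R hR c U hc hcle hU hUle β hβmin hβc μ hμ K hK A₃ hA3 L M _ _ hLβ hMβ m hm hmN hdat ω a'
  have hβ0 : 0 < β := pos_of_klBetaMin_le hβmin
  -- the frame's `C²` size is `≤ A = κ₀/4`
  have hlog : 1 ≤ Real.log 4 := by
    have h4 : Real.exp 1 ≤ 4 := by have := Real.exp_one_lt_d9; norm_num at this; linarith
    calc (1 : ℝ) = Real.log (Real.exp 1) := (Real.log_exp 1).symm
      _ ≤ Real.log 4 := Real.log_le_log (Real.exp_pos 1) h4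
  have hAK : ∀ p : Momentum, ∀ j ≤ 2, ‖iteratedFDeriv ℝ j (frameShift K) p‖ ≤ A := by
    intro p j hj
    refine (norm_iteratedFDeriv_frameShift_le_of_frameOK_regime hR hc.le hβmin hβc hK p hj).trans ?_
    have h0 := hR 0; have h1 := hR 1; have h2 := hR 2
    have hU1 : U ≤ 1 := hUle.trans (min_le_left _ _)
    have hUk : U ≤ κ₀ / (24 * (R.Gfr 0 + R.Gfr 1 + 1)) := hUle.trans (min_le_right _ _)
    rw [abs_of_pos hU]
    have hU2 : U ^ 2 ≤ U := by nlinarith only [hU, hU1]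
    have hA1 : 2 * R.Gfr 0 * U + 2 * R.Gfr 1 * U ^ 2 ≤ 2 * (R.Gfr 0 + R.Gfr 1 + 1) * U := by
      have := mul_le_mul_of_nonneg_left hU2 h1
      linarith only [this, hU.le]
    have hB1 : 2 * (R.Gfr 0 + R.Gfr 1 + 1) * U ≤ κ₀ / 12 := by
      have hpos : 0 < 24 * (R.Gfr 0 + R.Gfr 1 + 1) := by positivity
      have := (le_div_iff₀ hpos).mp hUk
      linarith only [this]
    have hC1 : R.Gfr 2 * (c / Real.log 4) ≤ R.Gfr 2 * c := mul_le_mul_of_nonneg_left (div_le_self hc.le hlog) h2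
    have hD1 : R.Gfr 2 * c ≤ κ₀ / 12 := by
      have hpos : 0 < 12 * (R.Gfr 2 + 1) := by positivity
      have := (le_div_iff₀ hpos).mp hcle
      linarith only [this, hc.le]
    rw [hAdef]; linarith only [hA1, hB1, hC1, hD1, hκ₀pos]
  -- the window margins
  have hμ' := hμ
  simp only [klWindowC, Set.mem_Icc] at hμ'
  have e1 : (-1.05 : ℝ) = -(21 / 20) := by norm_num
  have e2 : (-0.15 : ℝ) = -(3 / 20) := by norm_num
  have hμlo : -(21 / 20 : ℝ) ≤ μ := by rw [← e1]; exact hμ'.1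
  have hμhi : μ ≤ -(3 / 20 : ℝ) := by rw [← e2]; exact hμ'.2
  have he0 : klE0 = 1 / 32 := rfl
  have hgap : klE0 + A + (1 / 10 : ℝ) ^ 2 < -μ := by rw [he0, hAdef]; linarith only [hμhi, hκ₀40]
  have h3 : klE0 + A - μ ≤ 3 := by rw [he0, hAdef]; linarith only [hμlo, hκ₀40]
  have hlo : (-(6 / 5) : ℝ) ≤ μ - A - klE0 := by rw [he0, hAdef]; linarith only [hμlo, hκ₀40]
  have hhi : μ + A + klE0 ≤ -(1 / 10) := by rw [he0, hAdef]; linarith only [hμhi, hκ₀40]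
  have hADt : 2 * A < B.Dtmin := by rw [hAdef]; linarith
  have hρA : 4 * A < 2 * B.rhomin := by rw [hAdef]; linarith
  -- the scale thresholds (three steps)
  obtain ⟨hM, hMβ', hLz, hL16, hΛβ⟩ := regime_scale_thresholds₃ hβmin hLβ hMβ hmN
  have h := charSumWt_klAnisoPair_nb_le_frameKeyed (L := L) (M := M) (μ := μ) (K := K) B hAK hADt he (by norm_num : (0 : ℝ) < 1 / 10)
    (by norm_num : (1 / 10 : ℝ) ≤ 1) hgap h3 hlo hhi hβ0 hρA hd hd1 hd2 hd3 hA3 hBa hB hBa3 hB3 hcG hc1 hρb hY hκ hcT hκt hκ₃P hκc hKc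
    hκX hcN1 hcN2 hm hdat hM hMβ' hLz hL16 hΛβ ω a'
  refine h.trans (le_of_eq ?_)
  ring

end Summit.HubbardSuperconductivity.HubbardSuperconductivity.Theorems.TorusFourierL2

end
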